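import Summits.QuantumFields.YangMills.Theorems.BalabanLadderIRLightCodePincerDefs
import Summits.QuantumFields.YangMills.Theorems.DoublingDefectRecursionToGapSpectral
import HarnessLib
/-!
# Helper toward crux `BalabanLadder.IR` ∕ `IRcof` (stmt-QuantumFields-19354 ∕ 26930) — LINE D «rank-purity», part 1: OBJECTS, STATEMENTS,
# rank-`Q` BOOKKEEPING (ideator ym-ir-idea-14 gen 4; lens strengthen-to-induct applied to the residual token `N = IRnsc`)

HONESTY.  Nothing here proves the Clay Yang–Mills mass gap, a lattice gap, `IRnsc`, `IRcof` or `BalabanLadder.IR`; `R4` closes only the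
conditional finite-𝕋⁴ rung `BalabanLadder.UV`.  Sorry-free part 1 of the crux workfile `Cruxes/IR/Lines/rank_purity.lean` (card
`Cruxes/IR/Lines/rank-purity.md`): the canonical cold shape `coldExp`, ratio data `IsRatioDatum` (the shape produced by
`DoublingDefect.exists_ratios_hasSum_traceExcess`), the rank-`Q` tail `rankTail = traceExcess(m+2) − Σ_{j∈F} rr_j^{m+2}` (spectral weight
beyond the vacuum and `≤ Q` excused levels — for `π₁(G) ≠ 1` the excused levels are the 't Hooft flux vacua that kill every rank-0 purity,
`coldPressureOnsetAt_false_of_lightFluxMode`); the three OPEN propositions of the line as `def … : Prop` (PXᴷ `PinnedRankExit` = one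
rank-`Q`-pure cold torus per weak coupling in floor units; Rᴷ `RankTailSquaring` = the basin recursion `rankTail(S') ≤ C·rankTail(S)²`,
`S' ∈ [2S,4S]`, a NEW conjecture whose rank-0 case is the proved `AspectBootstrap.coldDefect_sq_le_two_pow`; BLINDᴷ `BlindGivenMultiplet` = the
flux-code half) and the strengthened statement S⁺ `MultipletPinned` (the W-currency `LightMultipletPressureAt r β Q (1/ξ)` pinned to the floor);
PROVED: `hasSum_rankTail`, `rankTail_nonneg`, `rankTail_le_exp_of_le` (propagation in the time extent), the RUNG `rankTail_double_le_sq`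
(the time-doubling half of Rᴷ holds at every rank), `exists_fin_pad`, and the achievable-bound infimum `infTail` with `infTail_recursion`.
Part 2 (`BalabanLadderIRRankPurity.lean`) proves the seam PXᴷ ∧ Rᴷ ⇒ S⁺ and the compositions to `IRnsc` ∕ `IR`.
-/

set_option autoImplicit false

noncomputable section

open MeasureTheory Filter Topology
open scoped BigOperators SchwartzMap
open Literature.MathematicalPhysics.QuantumFieldTheory Literature.MathematicalPhysics.QuantumLattice
open Summit.QuantumFields.YangMills.Cruxes.OSLegsFromFemtoAndGap.DlrCollarTransfer (GapInUnits LowerBounds)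
open Summit.QuantumFields.YangMills.Cruxes.IR.FluxCodeBlindness (LightMultipletPressureAt LightCodeCertificateAt)
open Summit.QuantumFields.YangMills.Theorems.DoublingDefect (exists_ratios_hasSum_traceExcess)

namespace Summit.QuantumFields.YangMills.Cruxes.IR.RankPurity

/-! ## §1 Objects: the canonical cold shape, ratio data, the rank-`Q` tail -/

/-- The minimal cold time exponent of the symmetric torus `(2S+1)³`: `coldExp S + 2 = ⌈(S+1)/2⌉` is the least `m + 2` in the cold
range `S + 1 ≤ 2(m+2)` of `ColdPressureBound` / `LightMultipletPressureAt` (aspect `≈ 4:1`). -/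
def coldExp (S : ℕ) : ℕ := (S - 2) / 2

/-- The canonical exponent is cold: `S + 1 ≤ 2 (coldExp S + 2)`. -/
theorem coldExp_cold (S : ℕ) : S + 1 ≤ 2 * (coldExp S + 2) := by
  unfold coldExp; omega

/-- The canonical exponent is the least cold one: `S + 1 ≤ 2(m+2) → coldExp S ≤ m`. -/
theorem coldExp_le {S m : ℕ} (h : S + 1 ≤ 2 * (m + 2)) : coldExp S ≤ m := by
  unfold coldExp; omega

/-- Upper bound `2 (coldExp S + 2) ≤ S + 4` (aspect ≈ 4:1). -/
theorem coldExp_add_two_le (S : ℕ) : 2 * (coldExp S + 2) ≤ S + 4 := by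
  unfold coldExp; omega

section Defs

variable {G : Type} [Group G] [TopologicalSpace G] [IsTopologicalGroup G] [CompactSpace G]
  [MeasurableSpace G] [BorelSpace G]

/-- **Ratio datum** of the cold torus with spatial cross-section `N³`: ratios `rᵢ ∈ [0,1]` indexed by a type `ι` with a vacuum index
`i₀`, `r_{i₀} = 1`, whose power sums off the vacuum are the trace excesses: `Σ_{i ≠ i₀} rᵢ^{m+2} = traceExcess ρ β N (m+2)` for all `m`.
The tree produces one from the transfer-matrix eigenbasis (`DoublingDefect.exists_ratios_hasSum_traceExcess`); any two ratio data have
the same non-zero values with multiplicity (power sums of all orders `≥ 2` agree), so statements quantified over ALL ratio data below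
are statements about the spectrum. -/
def IsRatioDatum {n : ℕ} (ρ : G →* Matrix (Fin n) (Fin n) ℂ) (β : ℝ) (N : ℕ) [NeZero N]
    (ι : Type) [DecidableEq ι] (rr : ι → ℝ) (i₀ : ι) : Prop :=
  (∀ i, 0 ≤ rr i ∧ rr i ≤ 1) ∧ rr i₀ = 1 ∧
    ∀ m : ℕ, HasSum (Function.update (fun i => rr i ^ (m + 2)) i₀ 0) (traceExcess ρ β N (m + 2))

/-- **The rank-`Q` tail** of a ratio datum at time extent `m + 2`, relative to a finite set `F` of removed («light») levels:
`traceExcess ρ β N (m+2) − Σ_{j ∈ F} r_j^{m+2}` — for `i₀ ∉ F` the total weight `Σ_{i ∉ F ∪ {i₀}} rᵢ^{m+2}` of the spectrum beyond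
the vacuum and the removed levels (`hasSum_rankTail`).  `F = ∅` is the trace excess itself (rank 0 = the cold-pressure currency). -/
def rankTail {n : ℕ} (ρ : G →* Matrix (Fin n) (Fin n) ℂ) (β : ℝ) (N : ℕ) [NeZero N]
    {ι : Type} (rr : ι → ℝ) (F : Finset ι) (m : ℕ) : ℝ :=
  traceExcess ρ β N (m + 2) - ∑ j ∈ F, rr j ^ (m + 2)

end Defs

/-! ## §2 The statements of LINE D -/

/-- **PXᴷ = `PinnedRankExit` (stub, THE NUMBERᴷ; non-simply-connected compact simple `G`).**  Under the crux's own hypotheses on the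
floor scale `a` there is a light rank `Q` (physically `|π₁(G)|³ − 1`) such that for every tolerance `θ > 0` and every lattice floor `S₀`
there are a pin `T` and a threshold `β₁` with: every `β ≥ β₁` has SOME cold symmetric torus `(2S+1)³ × (coldExp S + 2)`, `S ≥ S₀`,
of physical size `a(β)·(2S+1) ≤ T`, whose rank-`Q` tail is `≤ θ` (for every ratio datum, some `≤ Q` levels can be removed leaving
tail `≤ θ`).  The `π₁ ≠ 1` twin of `PinnedExit96.PinnedExitAt`; `∀ θ` (not `θ = 1/24`) because Rᴷ's constant is not known.
Why it might fail: it is confinement-at-the-floor-scale for the adjoint-type groups in contrapositive (no printed weak-coupling tool);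
false if light levels beyond the flux multiplet accumulate at the floor scale. -/
def PinnedRankExit : Prop :=
  ∀ (G : Type) [Group G] [TopologicalSpace G] [IsTopologicalGroup G] [CompactSpace G],
    IsCompactSimpleLieGroup G → ¬ SimplyConnectedSpace G →
    letI : MeasurableSpace G := borel G
    haveI : BorelSpace G := ⟨rfl⟩
    ∀ (r : LatticeRep G) (a : ℝ → ℝ), (∀ β, 0 < a β) → Tendsto a atTop (𝓝 0) → LowerBounds G r a →
      ∃ Q : ℕ, ∀ θ : ℝ, 0 < θ → ∀ S₀ : ℕ, ∃ T β₁ : ℝ, ∀ β : ℝ, β₁ ≤ β →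
        ∃ S : ℕ, S₀ ≤ S ∧ a β * ((2 * S + 1 : ℕ) : ℝ) ≤ T ∧
          ∀ (ι : Type) [DecidableEq ι] (rr : ι → ℝ) (i₀ : ι), IsRatioDatum r.ρ β (2 * S + 1) ι rr i₀ →
            ∃ F : Finset ι, i₀ ∉ F ∧ F.card ≤ Q ∧ rankTail r.ρ β (2 * S + 1) rr F (coldExp S) ≤ θ

/-- **Rᴷ = `RankTailSquaring` (stub, the INDUCTIVE STEP, BASIN FORM; non-simply-connected compact simple `G`, every rank `Q`).**
For every `r` and `Q` there are ONE constant `C`, a basin radius `η > 0`, a coupling threshold `β₀` and a lattice floor `S₀` such that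
for `β ≥ β₀`, `S ≥ S₀` and every `S' ∈ [2S, 4S]`: whenever `≤ Q` removed levels leave `rankTail(S) ≤ η` at cross-section `2S+1`, some
`≤ Q` levels can be removed at `2S'+1` with `rankTail(S') ≤ C · rankTail(S)²` (canonical cold shapes on both sides).  The premise
`≤ η` makes this the rank-`Q` analogue of the tree's basin shape `AbstractBasinRung*.AbstractBasin ε⋆ C` (nothing is claimed about boxes
that are not already `η`-pure modulo `Q`, in particular nothing about the femto ∕ hot corner where the trace excess is large); rank `0`
on simply-connected `G` is the PROVED sharp recursion `AspectBootstrap.coldDefect_sq_le_two_pow` in the cold-defect currency; rank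
`Q ≥ 1` is NEW and OPEN: the abstract [Sym][TM][Vol] proof of rank 0 does not extend (its `extension_le` step is a total-trace
inequality and loses `(S'/S − 1)·log(Q+1)` against a multiplet).  Why it might fail: a level that is light only in the bigger box — an
aspect-dependent flux energy crossing the removed set between `S` and `S'`, or levels accumulating at the floor scale — breaks one
`(C, η)` uniform in `β`; nothing rigorous supports it beyond rank 0, and a [Sym][TM][Vol] toy family with a planted multiplet may already
refute the abstract form. -/
def RankTailSquaring : Prop :=
  ∀ (G : Type) [Group G] [TopologicalSpace G] [IsTopologicalGroup G] [CompactSpace G],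
    IsCompactSimpleLieGroup G → ¬ SimplyConnectedSpace G →
    letI : MeasurableSpace G := borel G
    haveI : BorelSpace G := ⟨rfl⟩
    ∀ (r : LatticeRep G) (Q : ℕ), ∃ C η β₀ : ℝ, ∃ S₀ : ℕ, 0 < C ∧ 0 < η ∧ ∀ β : ℝ, β₀ ≤ β → ∀ S : ℕ, S₀ ≤ S →
      ∀ S' : ℕ, 2 * S ≤ S' → S' ≤ 4 * S →
        ∀ (ι : Type) [DecidableEq ι] (rr : ι → ℝ) (i₀ : ι), IsRatioDatum r.ρ β (2 * S + 1) ι rr i₀ →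
          ∀ F : Finset ι, i₀ ∉ F → F.card ≤ Q → rankTail r.ρ β (2 * S + 1) rr F (coldExp S) ≤ η →
            ∀ (ι' : Type) [DecidableEq ι'] (rr' : ι' → ℝ) (i₀' : ι'), IsRatioDatum r.ρ β (2 * S' + 1) ι' rr' i₀' →
              ∃ F' : Finset ι', i₀' ∉ F' ∧ F'.card ≤ Q ∧
                rankTail r.ρ β (2 * S' + 1) rr' F' (coldExp S') ≤ C * rankTail r.ρ β (2 * S + 1) rr F (coldExp S) ^ 2

/-- **S⁺ = `MultipletPinned` (the strengthened statement; PROVED below from PXᴷ ∧ Rᴷ).**  For non-simply-connected compact simple `G`,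
under the crux's hypotheses on `a`: a light rank `Q`, a pin `T` and a threshold `β₂` such that every `β ≥ β₂` carries a length `ξ ≥ 1`
of at most `T` floor-lengths (`a β · ξ ≤ T`) with cold pressure modulo a light multiplet of rank `Q` at rate `1/ξ`
(`FluxCodeBlindness.LightMultipletPressureAt r β Q (1/ξ)`: on EVERY cold symmetric torus beyond a threshold the trace excess minus
`≤ Q` light levels is `≤ C₀ (2S+1)³ e^{−(m+2)/ξ}`). -/
def MultipletPinned : Prop :=
  ∀ (G : Type) [Group G] [TopologicalSpace G] [IsTopologicalGroup G] [CompactSpace G],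
    IsCompactSimpleLieGroup G → ¬ SimplyConnectedSpace G →
    letI : MeasurableSpace G := borel G
    haveI : BorelSpace G := ⟨rfl⟩
    ∀ (r : LatticeRep G) (a : ℝ → ℝ), (∀ β, 0 < a β) → Tendsto a atTop (𝓝 0) → LowerBounds G r a →
      ∃ (Q : ℕ) (T β₂ : ℝ), ∀ β : ℝ, β₂ ≤ β →
        ∃ ξ : ℕ, 1 ≤ ξ ∧ a β * (ξ : ℝ) ≤ T ∧ LightMultipletPressureAt r β Q (1 / (ξ : ℝ))

/-- **BLINDᴷ = `BlindGivenMultiplet` (stub, XL — the flux-code property; non-simply-connected compact simple `G`).**  GIVEN cold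
pressure modulo a pinned light multiplet (the W-currency of S⁺, for some rank, pin and threshold), the light levels form a CODE for the
local gauge-invariant observables: the light-code certificate of `FluxCodeBlindness` holds at a pinned light-code length — exactly the
hypotheses `hon`/`hpin` of the landed seam `gapInUnits_of_lightCode_pinned`.  Content: local indistinguishability of the 't Hooft flux
vacua (sector-mean blindness, electric-flux superselection at width `wd A B`) — the code half of card ym19354-5's `I_code` in floor
units; the fixed-β located pieces are crux 16405's stubs EBLIND/SPLIT/EQUI.  Species-quantified by necessity
(`FluxCodeBlindness.abs_sectorMean_sub_mean_le`: blindness is necessary for clustering).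
Why it might fail: it is the dynamical statement that NO quasi-local observable separates the flux sectors at weak coupling (no order
parameter for the magnetic ℤ_{|π₁|} one-form symmetry) — open; as typed it also asks for finite-dimensional light-code MODELS
approximating every lattice correlator, an extra approximation layer that may be mis-cut. -/
def BlindGivenMultiplet : Prop :=
  ∀ (G : Type) [Group G] [TopologicalSpace G] [IsTopologicalGroup G] [CompactSpace G],
    IsCompactSimpleLieGroup G → ¬ SimplyConnectedSpace G →
    letI : MeasurableSpace G := borel G
    haveI : BorelSpace G := ⟨rfl⟩
    ∀ (r : LatticeRep G) (a : ℝ → ℝ), (∀ β, 0 < a β) →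
      (∃ (Q : ℕ) (T β₂ : ℝ), ∀ β : ℝ, β₂ ≤ β →
        ∃ ξ : ℕ, 1 ≤ ξ ∧ a β * (ξ : ℝ) ≤ T ∧ LightMultipletPressureAt r β Q (1 / (ξ : ℝ))) →
      ∃ (Q : ℕ) (wd : YMSpecies G → YMSpecies G → ℕ) (ξ : ℝ → ℕ) (β₂ T : ℝ),
        (∀ β : ℝ, β₂ ≤ β → 1 ≤ ξ β ∧ LightCodeCertificateAt r β Q (1 / (ξ β : ℝ)) wd) ∧
        (∀ β : ℝ, β₂ ≤ β → a β * (ξ β : ℝ) < T)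

/-! ## §3 Rank-`Q` spectral bookkeeping (PROVED) -/

section Spectral

variable {G : Type} [Group G] [TopologicalSpace G] [IsTopologicalGroup G] [CompactSpace G]
  [MeasurableSpace G] [BorelSpace G]

/-- The tree's transfer-matrix eigen-data are a ratio datum (`exists_ratios_hasSum_traceExcess`). -/
theorem exists_ratioDatum [SecondCountableTopology G] (r : LatticeRep G) {β : ℝ} (hβ : 0 ≤ β) (N : ℕ) [NeZero N] :
    ∃ (ι : Type) (_ : DecidableEq ι) (rr : ι → ℝ) (i₀ : ι), IsRatioDatum r.ρ β N ι rr i₀ := by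
  obtain ⟨ι, hdec, rr, i₀, hr, h1, -, -, hx⟩ := exists_ratios_hasSum_traceExcess r.continuous r.mem_unitary hβ N
  exact ⟨ι, hdec, rr, i₀, hr, h1, hx⟩

variable {n : ℕ} {ρ : G →* Matrix (Fin n) (Fin n) ℂ} {β : ℝ} {N : ℕ} [NeZero N]
  {ι : Type} [DecidableEq ι] {rr : ι → ℝ} {i₀ : ι}

/-- **The rank-`Q` tail is the sum over the complement**: `Σ_{i ∉ insert i₀ F} rᵢ^{m+2} = rankTail … F m` for `i₀ ∉ F`. -/
theorem hasSum_rankTail (hd : IsRatioDatum ρ β N ι rr i₀) {F : Finset ι} (hF : i₀ ∉ F) (m : ℕ) :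
    HasSum (fun i => if i ∈ insert i₀ F then (0 : ℝ) else rr i ^ (m + 2)) (rankTail ρ β N rr F m) := by
  have h1 := hd.2.2 m
  have h2 : HasSum (fun i => if i ∈ F then rr i ^ (m + 2) else 0) (∑ j ∈ F, rr j ^ (m + 2)) := by
    have h : HasSum (fun i => if i ∈ F then rr i ^ (m + 2) else 0)
        (∑ b ∈ F, (if b ∈ F then rr b ^ (m + 2) else 0)) :=
      hasSum_sum_of_ne_finset_zero (fun b hb => if_neg hb)
    have hs : ∑ b ∈ F, (if b ∈ F then rr b ^ (m + 2) else 0) = ∑ j ∈ F, rr j ^ (m + 2) :=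
      Finset.sum_congr rfl fun j hj => if_pos hj
    rw [hs] at h
    exact h
  have h3 := h1.sub h2
  have hfun : (fun i => if i ∈ insert i₀ F then (0 : ℝ) else rr i ^ (m + 2)) =
      (fun b => Function.update (fun i => rr i ^ (m + 2)) i₀ 0 b - if b ∈ F then rr b ^ (m + 2) else 0) := by
    funext i
    rcases eq_or_ne i i₀ with rfl | hne
    · simp [hF]
    · rw [Function.update_of_ne hne]
      by_cases hi : i ∈ F
      · simp [hi]
      · simp [hi, hne]
  rw [hfun]
  unfold rankTail
  exact h3

/-- The rank-`Q` tail is non-negative (for `i₀ ∉ F`). -/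
theorem rankTail_nonneg (hd : IsRatioDatum ρ β N ι rr i₀) {F : Finset ι} (hF : i₀ ∉ F) (m : ℕ) :
    0 ≤ rankTail ρ β N rr F m := by
  refine (hasSum_rankTail hd hF m).nonneg fun i => ?_
  split_ifs
  · exact le_rfl
  · exact pow_nonneg (hd.1 i).1 _

/-- **Rank-`Q` propagation in the time extent** (the rank-`Q` twin of `DoublingDefect.traceExcess_le_exp_of_le`): if the tail beyond
`F` is `≤ e^{−c(m+2)}` at extent `m + 2`, then it is `≤ e^{−c(k+2)}` at every extent `k + 2 ≥ m + 2` — each remaining ratio is at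
most `e^{−c}` (one term ≤ the sum), and the `(k+2)`-tail is termwise `≤ e^{−c(k−m)}` times the `(m+2)`-tail. -/
theorem rankTail_le_exp_of_le (hd : IsRatioDatum ρ β N ι rr i₀) {F : Finset ι} (hF : i₀ ∉ F) {m k : ℕ} (hmk : m ≤ k)
    {c : ℝ} (h₀ : rankTail ρ β N rr F m ≤ Real.exp (-(c * ((m + 2 : ℕ) : ℝ)))) :
    rankTail ρ β N rr F k ≤ Real.exp (-(c * ((k + 2 : ℕ) : ℝ))) := by
  have hx₀ := hasSum_rankTail hd hF m
  have hxk := hasSum_rankTail hd hF k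
  set q : ℝ := Real.exp (-c) with hq
  have hq0 : 0 ≤ q := (Real.exp_pos _).le
  have hexp : ∀ j : ℕ, Real.exp (-(c * (j : ℝ))) = q ^ j := fun j => by
    rw [hq, ← Real.exp_nat_mul]; ring_nf
  rw [hexp (m + 2)] at h₀
  rw [hexp (k + 2)]
  have hg0 : ∀ i, 0 ≤ (if i ∈ insert i₀ F then (0 : ℝ) else rr i ^ (m + 2)) := fun i => by
    split_ifs
    · exact le_rfl
    · exact pow_nonneg (hd.1 i).1 _
  -- each remaining ratio is `≤ q`
  have hri : ∀ i, i ∉ insert i₀ F → rr i ≤ q := fun i hi => by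
    have h1 : rr i ^ (m + 2) ≤ rankTail ρ β N rr F m := by
      have h := le_hasSum hx₀ i fun j _ => hg0 j
      rwa [if_neg hi] at h
    exact (pow_le_pow_iff_left₀ (hd.1 i).1 hq0 (by omega : m + 2 ≠ 0)).1 (h1.trans h₀)
  have hcmp : ∀ i, (if i ∈ insert i₀ F then (0 : ℝ) else rr i ^ (k + 2)) ≤
      q ^ (k - m) * (if i ∈ insert i₀ F then (0 : ℝ) else rr i ^ (m + 2)) := fun i => by
    by_cases hi : i ∈ insert i₀ F
    · simp [hi]
    · rw [if_neg hi, if_neg hi]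
      have hsplit : rr i ^ (k + 2) = rr i ^ (k - m) * rr i ^ (m + 2) := by
        rw [← pow_add]; congr 1; omega
      rw [hsplit]
      exact mul_le_mul_of_nonneg_right (pow_le_pow_left₀ (hd.1 i).1 (hri i hi) _) (pow_nonneg (hd.1 i).1 _)
  have hsum := hasSum_le hcmp hxk (hx₀.mul_left (q ^ (k - m)))
  calc rankTail ρ β N rr F k ≤ q ^ (k - m) * rankTail ρ β N rr F m := hsum
    _ ≤ q ^ (k - m) * q ^ (m + 2) := mul_le_mul_of_nonneg_left h₀ (pow_nonneg hq0 _)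
    _ = q ^ (k + 2) := by rw [← pow_add]; congr 1; omega

omit [NeZero N] [DecidableEq ι] in
/-- Padding: `≤ Q` removed levels give a light vector `θ : Fin Q → [0,1]` with the same power sums (zeros appended). -/
theorem exists_fin_pad (hr : ∀ i, 0 ≤ rr i ∧ rr i ≤ 1) (F : Finset ι) {Q : ℕ} (hQ : F.card ≤ Q) :
    ∃ θ : Fin Q → ℝ, (∀ k, 0 ≤ θ k ∧ θ k ≤ 1) ∧ ∀ p : ℕ, ∑ k, θ k ^ (p + 2) = ∑ j ∈ F, rr j ^ (p + 2) := by
  obtain ⟨d, rfl⟩ := Nat.exists_eq_add_of_le hQ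
  refine ⟨Fin.append (fun k : Fin F.card => rr (F.equivFin.symm k)) (fun _ : Fin d => (0 : ℝ)),
    fun k => ?_, fun p => ?_⟩
  · induction k using Fin.addCases with
    | left i => simpa using hr _
    | right j => simp
  · rw [Fin.sum_univ_add]
    simp only [Fin.append_left, Fin.append_right]
    rw [zero_pow (by omega : p + 2 ≠ 0), Finset.sum_const_zero, add_zero,
      ← Finset.sum_coe_sort F (fun j => rr j ^ (p + 2))]
    exact F.equivFin.symm.sum_comp (fun x => rr (x : ι) ^ (p + 2))


/-- **The time-doubling half of Rᴷ is a theorem at every rank** (rung).  For the SAME torus and the same excused set, doubling the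
time exponent squares the rank-`Q` tail: `rankTail(2m+2) ≤ rankTail(m)²` (i.e. exponent `m+2 ↦ 2(m+2)`; `Σ aᵢ² ≤ (Σ aᵢ)²` on the
complement of `insert i₀ F`).  Hence the OPEN content of Rᴷ is entirely the SPATIAL growth `2S+1 ↦ 2S'+1` of the cross-section. -/
theorem rankTail_double_le_sq (hd : IsRatioDatum ρ β N ι rr i₀) {F : Finset ι} (hF : i₀ ∉ F) (m : ℕ) :
    rankTail ρ β N rr F (2 * m + 2) ≤ rankTail ρ β N rr F m ^ 2 := by
  have hT := hasSum_rankTail hd hF m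
  have h2 := hasSum_rankTail hd hF (2 * m + 2)
  have hnn : ∀ i, 0 ≤ (if i ∈ insert i₀ F then (0 : ℝ) else rr i ^ (m + 2)) := fun i => by
    split_ifs
    · exact le_rfl
    · exact pow_nonneg (hd.1 i).1 _
  have hle : ∀ i, (if i ∈ insert i₀ F then (0 : ℝ) else rr i ^ (m + 2)) ≤ rankTail ρ β N rr F m := fun i =>
    le_hasSum hT i (fun j _ => hnn j)
  have hmul := hT.mul_right (rankTail ρ β N rr F m)
  have key : ∀ i, (if i ∈ insert i₀ F then (0 : ℝ) else rr i ^ (2 * m + 2 + 2)) ≤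
      (if i ∈ insert i₀ F then (0 : ℝ) else rr i ^ (m + 2)) * rankTail ρ β N rr F m := fun i => by
    by_cases h : i ∈ insert i₀ F
    · simp [h]
    · have hpow : rr i ^ (2 * m + 2 + 2) = rr i ^ (m + 2) * rr i ^ (m + 2) := by
        rw [← pow_add]; ring_nf
      have hi : rr i ^ (m + 2) ≤ rankTail ρ β N rr F m := by simpa [h] using hle i
      simpa [h, hpow] using mul_le_mul_of_nonneg_left hi (pow_nonneg (hd.1 i).1 (m + 2))
  have := hasSum_le key h2 hmul
  simpa [sq] using this

end Spectral

/-! ## §4 The infimum of achievable tail bounds and its recursion (PROVED) -/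

section Achievable

variable {G : Type} [Group G] [TopologicalSpace G] [IsTopologicalGroup G] [CompactSpace G]
  [MeasurableSpace G] [BorelSpace G]

/-- Achievable rank-`Q` tail bounds at cross-section `2S+1` (canonical cold shape): reals `x` such that EVERY ratio datum admits
`≤ Q` removed levels with tail `≤ x` — the datum-free shape in which PXᴷ and Rᴷ speak. -/
def achievable (r : LatticeRep G) (β : ℝ) (Q S : ℕ) : Set ℝ :=
  {x | ∀ (ι : Type) [DecidableEq ι] (rr : ι → ℝ) (i₀ : ι), IsRatioDatum r.ρ β (2 * S + 1) ι rr i₀ →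
    ∃ F : Finset ι, i₀ ∉ F ∧ F.card ≤ Q ∧ rankTail r.ρ β (2 * S + 1) rr F (coldExp S) ≤ x}

/-- The optimal rank-`Q` tail `δ_Q(β, S) := inf achievable` — the inductive quantity of LINE D. -/
def infTail (r : LatticeRep G) (β : ℝ) (Q S : ℕ) : ℝ :=
  sInf (achievable r β Q S)

variable (r : LatticeRep G) (β : ℝ) (Q S : ℕ)

/-- The trivial bound (excuse nothing): the trace excess itself is achievable. -/
theorem traceExcess_mem_achievable :
    traceExcess r.ρ β (2 * S + 1) (coldExp S + 2) ∈ achievable r β Q S :=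
  fun ι _ rr i₀ _ => ⟨∅, by simp, by simp, by simp [rankTail]⟩

/-- The achievable set is nonempty. -/
theorem achievable_nonempty : (achievable r β Q S).Nonempty :=
  ⟨_, traceExcess_mem_achievable r β Q S⟩

variable {r β Q S}

/-- The achievable set is upward closed. -/
theorem mem_achievable_of_le {x y : ℝ} (hx : x ∈ achievable r β Q S) (hxy : x ≤ y) : y ∈ achievable r β Q S :=
  fun ι _ rr i₀ hd => by
    obtain ⟨F, hF, hc, hle⟩ := hx ι rr i₀ hd
    exact ⟨F, hF, hc, hle.trans hxy⟩

/-- Achievable bounds are nonnegative (test them on the tree's spectral datum). -/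
theorem nonneg_of_mem_achievable [SecondCountableTopology G] (hβ : 0 ≤ β) {x : ℝ} (hx : x ∈ achievable r β Q S) :
    0 ≤ x := by
  obtain ⟨ι, hdec, rr, i₀, hd⟩ := exists_ratioDatum r hβ (2 * S + 1)
  obtain ⟨F, hF, -, hle⟩ := hx ι rr i₀ hd
  exact (rankTail_nonneg hd hF _).trans hle

/-- `0 ≤ infTail`. -/
theorem infTail_nonneg [SecondCountableTopology G] (hβ : 0 ≤ β) : 0 ≤ infTail r β Q S :=
  le_csInf (achievable_nonempty r β Q S) fun _ hx => nonneg_of_mem_achievable hβ hx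

/-- `infTail` is below every achievable bound. -/
theorem infTail_le_of_mem [SecondCountableTopology G] (hβ : 0 ≤ β) {x : ℝ} (hx : x ∈ achievable r β Q S) :
    infTail r β Q S ≤ x :=
  csInf_le ⟨0, fun _ hy => nonneg_of_mem_achievable hβ hy⟩ hx

/-- Anything strictly above `infTail` is achievable. -/
theorem mem_achievable_of_infTail_lt {x : ℝ} (h : infTail r β Q S < x) : x ∈ achievable r β Q S := by
  obtain ⟨y, hy, hyx⟩ := exists_lt_of_csInf_lt (achievable_nonempty r β Q S) h
  exact mem_achievable_of_le hy hyx.le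

/-- **The recursion passes to the infimum** (basin form): if `δ_Q(S) < η`, Rᴷ's clause at `(β, S, S')` gives
`δ_Q(S') ≤ C · δ_Q(S)²`. -/
theorem infTail_recursion [SecondCountableTopology G] (hβ : 0 ≤ β) {C η : ℝ} (hC : 0 ≤ C) {S' : ℕ}
    (hlt : infTail r β Q S < η)
    (hRK : ∀ (ι : Type) [DecidableEq ι] (rr : ι → ℝ) (i₀ : ι), IsRatioDatum r.ρ β (2 * S + 1) ι rr i₀ →
      ∀ F : Finset ι, i₀ ∉ F → F.card ≤ Q → rankTail r.ρ β (2 * S + 1) rr F (coldExp S) ≤ η →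
        ∀ (ι' : Type) [DecidableEq ι'] (rr' : ι' → ℝ) (i₀' : ι'), IsRatioDatum r.ρ β (2 * S' + 1) ι' rr' i₀' →
          ∃ F' : Finset ι', i₀' ∉ F' ∧ F'.card ≤ Q ∧
            rankTail r.ρ β (2 * S' + 1) rr' F' (coldExp S') ≤ C * rankTail r.ρ β (2 * S + 1) rr F (coldExp S) ^ 2) :
    infTail r β Q S' ≤ C * infTail r β Q S ^ 2 := by
  have key : ∀ ε : ℝ, 0 < ε → infTail r β Q S + ε < η → infTail r β Q S' ≤ C * (infTail r β Q S + ε) ^ 2 := by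
    intro ε hε hεη
    have hx : infTail r β Q S + ε ∈ achievable r β Q S := mem_achievable_of_infTail_lt (by linarith)
    refine infTail_le_of_mem hβ fun ι' _ rr' i₀' hd' => ?_
    obtain ⟨ι, hdec, rr, i₀, hd⟩ := exists_ratioDatum r hβ (2 * S + 1)
    obtain ⟨F, hF, hcard, hle⟩ := hx ι rr i₀ hd
    obtain ⟨F', hF', hcard', hle'⟩ := hRK ι rr i₀ hd F hF hcard (hle.trans hεη.le) ι' rr' i₀' hd'
    refine ⟨F', hF', hcard', hle'.trans ?_⟩
    have h0 : 0 ≤ rankTail r.ρ β (2 * S + 1) rr F (coldExp S) := rankTail_nonneg hd hF _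
    exact mul_le_mul_of_nonneg_left (pow_le_pow_left₀ h0 hle 2) hC
  have ht : Tendsto (fun ε : ℝ => C * (infTail r β Q S + ε) ^ 2) (𝓝[>] 0)
      (𝓝 (C * (infTail r β Q S + 0) ^ 2)) :=
    ((continuous_const.mul ((continuous_const.add continuous_id).pow 2)).tendsto 0).mono_left
      nhdsWithin_le_nhds
  rw [add_zero] at ht
  have hev : ∀ᶠ ε in 𝓝[>] (0 : ℝ), infTail r β Q S' ≤ C * (infTail r β Q S + ε) ^ 2 := by
    have hmem : Set.Ioo (0 : ℝ) (η - infTail r β Q S) ∈ 𝓝[>] (0 : ℝ) := Ioo_mem_nhdsGT (by linarith)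
    filter_upwards [hmem] with ε hε
    exact key ε hε.1 (by linarith [hε.2])
  exact ge_of_tendsto ht hev

end Achievable

end Summit.QuantumFields.YangMills.Cruxes.IR.RankPurity

end
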